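import Summits.Ventures.YMGap.RobustBall.FreeEnergyLaw
import Summits.Ventures.YMGap.RobustBall.FreeEnergyDifferentiable
import HarnessLib

/-!
# Robust ball (Y2), area-law side — THE FREE-ENERGY LAW IN RATIO FORM and its cells in every dimension / for every `N`

HONEST FRAMING: venture file of the cell `pub-ymgap` (QuantumFields programme), track ROBUST-BALL, seat rb-p2 (g7).  LATTICE statements,
Wilson action, `G ≅ SU(N)`; sequel of `FreeEnergyLaw.lean` (tree functional `freeEnergyDensity d ρ β`, Wave-0 normalisation).  WHAT IS NEW:
* ★★ `freeEnergy_ratio_limit` — the law in ratio form for every `N ≥ 2`, `d ≥ 2`: `(f(β) + #planes·N·β)/(#planes·V₀β²/2) → 1` as `β → 0⁺`,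
  with `|· − 1| ≤ ε` for `0 < β ≤ log(1+ε)/((2(d−1)(2d+1) + 8(d−1)²)N)`;
* `su2_exists_hasFreeEnergyDensity_two_sided_dim4` — existence of the thermodynamic limit and the `SU(2)` `ℤ⁴` law in one statement;
* `su3_freeEnergy_two_sided_dim4` — `SU(3)` in Wilson's normalisation: `(1/6)β_W² e^{−54β_W} ≤ f(β_W/3) + 6β_W ≤ (1/6)β_W² e^{72β_W}`;
* `su2_freeEnergy_two_sided` — `SU(2)` in EVERY dimension `d = n + 1 ≥ 2`: `(n(n+1)/16)β_W² e^{−2n(2n+3)β_W} ≤ f(β_W/2) + (n(n+1)/2)β_W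
  ≤ (n(n+1)/16)β_W² e^{8n²β_W}` (`FreeEnergyDifferentiable.card_planes_real`: `#planes = n(n+1)/2`);
* `suN_freeEnergy_two_sided_dim3` — every `N ≥ 3` on the `YM₃` lattices: `(3/4)β² e^{−28Nβ} ≤ f(β) + 3Nβ ≤ (3/4)β² e^{32Nβ}`.
WHAT IT IS NOT: the leading term is exact, the windows are one-link artefacts; nothing continuum / spectral / Clay.  0 compute.  Everything here is
proved. [folklore]
-/

noncomputable section

open MeasureTheory Filter Topology Finset
open Literature.MathematicalPhysics.QuantumLattice
open Literature.MathematicalPhysics.QuantumFieldTheory hiding ZdEdge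

namespace Summit.Ventures.YMGap.RobustBall

namespace FreeEnergyLaw

/-! ### The law in ratio form, every `N` and `d` -/

section Ratio

variable {d N : ℕ} {G : Type*} [Group G] [TopologicalSpace G] [IsTopologicalGroup G]
  [CompactSpace G] [MeasurableSpace G] [BorelSpace G] [SecondCountableTopology G] [T2Space G]
  (ρ : G →* Matrix (Fin N) (Fin N) ℂ)

/-- ★★ **THE FREE-ENERGY LAW IN RATIO FORM, every `G ≅ SU(N)`, `N ≥ 2`, `d ≥ 2`**: the interaction pressure over its leading term
tends to `1` as `β → 0⁺` with an explicit rate — `∀ ε > 0 ∃ β₀ > 0 ∀ 0 < β ≤ β₀`,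
`|(f(β) + #planes·N·β)/(#planes·V₀β²/2) − 1| ≤ ε`, `β₀ = log(1+ε)/((2(d−1)(2d+1) + 8(d−1)²)N)`. [folklore] -/
theorem freeEnergy_ratio_limit (hρ : IsSpecialUnitaryModel ρ) (hN : 2 ≤ N) (hd : 2 ≤ d) (ε : ℝ) (hε : 0 < ε) :
    ∃ β₀ : ℝ, 0 < β₀ ∧ ∀ β : ℝ, 0 < β → β ≤ β₀ →
      |(freeEnergyDensity d ρ β + (Fintype.card {q : Fin d × Fin d // q.1 < q.2} : ℝ) * N * β) /
          ((Fintype.card {q : Fin d × Fin d // q.1 < q.2} : ℝ) * (PlaquetteLowerBound.charVariance ρ * β ^ 2 / 2)) - 1| ≤ ε := by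
  set D : ℝ := (Fintype.card {q : Fin d × Fin d // q.1 < q.2} : ℝ) with hDdef
  have hD : 0 < D := by
    have h01 : (⟨0, by omega⟩ : Fin d) < ⟨1, by omega⟩ := Fin.mk_lt_mk.2 (by norm_num)
    have : 0 < Fintype.card {q : Fin d × Fin d // q.1 < q.2} :=
      Fintype.card_pos_iff.2 ⟨⟨(⟨0, by omega⟩, ⟨1, by omega⟩), h01⟩⟩
    rw [hDdef]; exact_mod_cast this
  have hV : 0 < PlaquetteLowerBound.charVariance ρ := PlaquetteLowerBound.charVariance_pos ρ hρ.1 (by omega)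
  have hN0 : (0 : ℝ) < N := by exact_mod_cast (show 0 < N by omega)
  set c : ℝ := 2 * ((d : ℝ) - 1) * (2 * (d : ℝ) + 1) * N + 8 * ((d : ℝ) - 1) ^ 2 * N with hc
  have hd1 : (0 : ℝ) < (d : ℝ) - 1 := by
    have : (2 : ℝ) ≤ d := by exact_mod_cast hd
    linarith
  have hc₁pos : 0 < 2 * ((d : ℝ) - 1) * (2 * (d : ℝ) + 1) * N := by positivity
  have hc₂pos : 0 < 8 * ((d : ℝ) - 1) ^ 2 * N := by positivity
  have hcpos : 0 < c := by rw [hc]; positivity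
  have hc₁le : 2 * ((d : ℝ) - 1) * (2 * (d : ℝ) + 1) * N ≤ c := by rw [hc]; linarith
  have hc₂le : 8 * ((d : ℝ) - 1) ^ 2 * N ≤ c := by rw [hc]; linarith
  have hL : 0 < Real.log (1 + ε) := Real.log_pos (by linarith)
  refine ⟨Real.log (1 + ε) / c, by positivity, fun β hβ hβ0 => ?_⟩
  obtain ⟨h1, h2⟩ := freeEnergyDensity_two_sided (d := d) ρ hρ hN hd hβ.le
  set F : ℝ := freeEnergyDensity d ρ β + D * N * β with hF
  set u : ℝ := D * (PlaquetteLowerBound.charVariance ρ * β ^ 2 / 2) with hu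
  have hupos : 0 < u := by positivity
  have hFpos : 0 < F := lt_of_lt_of_le (by positivity) h1
  have hcβ : c * β ≤ Real.log (1 + ε) := by
    have := mul_le_mul_of_nonneg_left hβ0 hcpos.le
    rwa [mul_div_cancel₀ _ hcpos.ne'] at this
  have hc₁β : 2 * ((d : ℝ) - 1) * (2 * (d : ℝ) + 1) * N * β ≤ c * β := mul_le_mul_of_nonneg_right hc₁le hβ.le
  have hc₂β : 8 * ((d : ℝ) - 1) ^ 2 * N * β ≤ c * β := mul_le_mul_of_nonneg_right hc₂le hβ.le
  -- `log F − log u ∈ [−c₁β, c₂β]`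
  have hlog1 : -(2 * ((d : ℝ) - 1) * (2 * (d : ℝ) + 1) * N * β) ≤ Real.log F - Real.log u := by
    have h := Real.log_le_log (by positivity) h1
    rw [Real.log_mul hupos.ne' (Real.exp_pos _).ne', Real.log_exp] at h
    linarith
  have hlog2 : Real.log F - Real.log u ≤ c * β := by
    have h := Real.log_le_log hFpos h2
    rw [Real.log_mul hupos.ne' (Real.exp_pos _).ne', Real.log_exp] at h
    linarith
  have hratio : F / u = Real.exp (Real.log F - Real.log u) := by
    rw [Real.exp_sub, Real.exp_log hFpos, Real.exp_log hupos]
  rw [hratio, abs_le]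
  constructor
  · have hx := Real.add_one_le_exp (Real.log F - Real.log u)
    have hlog_le : Real.log (1 + ε) ≤ ε := by
      have := Real.log_le_sub_one_of_pos (by linarith : (0 : ℝ) < 1 + ε)
      linarith
    linarith
  · have hx : Real.exp (Real.log F - Real.log u) ≤ Real.exp (Real.log (1 + ε)) := Real.exp_le_exp.2 (by linarith)
    rw [Real.exp_log (by linarith)] at hx
    linarith

/-- ★ **Existence + law in one statement** (`SU(2)`, `d = 4`): for every `β_W ≥ 0` the free energy density EXISTS as the full
thermodynamic limit (`HasFreeEnergyDensity`, tree `exists_hasFreeEnergyDensity_holds`) and obeys the two-sided strong-coupling law.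
[folklore] -/
theorem su2_exists_hasFreeEnergyDensity_two_sided_dim4 {βW : ℝ} (hβ : 0 ≤ βW) :
    ∃ f : ℝ, HasFreeEnergyDensity 4 (fundamentalRep (Fin 2)) (βW / 2) f ∧
      3 / 4 * βW ^ 2 * Real.exp (-(54 * βW)) ≤ f + 6 * βW ∧ f + 6 * βW ≤ 3 / 4 * βW ^ 2 * Real.exp (72 * βW) := by
  have hρ := TorusAreaLaw.isSpecialUnitaryModel_fundamentalRep 2
  refine ⟨freeEnergyDensity 4 (fundamentalRep (Fin 2)) (βW / 2),
    hasFreeEnergyDensity_freeEnergyDensity _ (exists_hasFreeEnergyDensity_holds (d := 4) _ hρ.1 _),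
    su2_freeEnergy_two_sided_dim4 hβ⟩

/-- ★ **SU(3), `d = 4`, in Wilson's normalisation** (tree coupling `β_W/3`): for every `β_W ≥ 0`,
`(1/6)β_W² e^{−54β_W} ≤ f(β_W/3) + 6β_W ≤ (1/6)β_W² e^{72β_W}` (`(1/6)β_W²` = six plaquettes per site `× β_W²/36`, the
`β_W²`-coefficient of the one-plaquette `SU(3)` integral `log ∫ e^{(β_W/3) Re tr U} dU`, `V₀(SU(3)) = 1/2`). [folklore] -/
theorem su3_freeEnergy_two_sided_dim4 {βW : ℝ} (hβ : 0 ≤ βW) :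
    1 / 6 * βW ^ 2 * Real.exp (-(54 * βW)) ≤ freeEnergyDensity 4 (fundamentalRep (Fin 3)) (βW / 3) + 6 * βW ∧
      freeEnergyDensity 4 (fundamentalRep (Fin 3)) (βW / 3) + 6 * βW ≤ 1 / 6 * βW ^ 2 * Real.exp (72 * βW) := by
  obtain ⟨h1, h2⟩ := suN_freeEnergy_two_sided_dim4 (N := 3) le_rfl (by positivity : (0 : ℝ) ≤ βW / 3)
  push_cast at h1 h2
  constructor
  · have e1 : 1 / 6 * βW ^ 2 * Real.exp (-(54 * βW)) = 3 / 2 * (βW / 3) ^ 2 * Real.exp (-(54 * 3 * (βW / 3))) := by ring_nf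
    have e2 : freeEnergyDensity 4 (fundamentalRep (Fin 3)) (βW / 3) + 6 * 3 * (βW / 3) =
        freeEnergyDensity 4 (fundamentalRep (Fin 3)) (βW / 3) + 6 * βW := by ring
    rw [e1, ← e2]; exact h1
  · have e1 : 1 / 6 * βW ^ 2 * Real.exp (72 * βW) = 3 / 2 * (βW / 3) ^ 2 * Real.exp (72 * 3 * (βW / 3)) := by ring_nf
    have e2 : freeEnergyDensity 4 (fundamentalRep (Fin 3)) (βW / 3) + 6 * 3 * (βW / 3) =
        freeEnergyDensity 4 (fundamentalRep (Fin 3)) (βW / 3) + 6 * βW := by ring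
    rw [e1, ← e2]; exact h2

/-- ★ **SU(2), every dimension `d = n + 1 ≥ 2`**: for every `β_W ≥ 0`,
`(n(n+1)/16) β_W² e^{−2n(2n+3)β_W} ≤ f_{n+1}(β_W/2) + (n(n+1)/2) β_W ≤ (n(n+1)/16) β_W² e^{8n²β_W}`
(`n(n+1)/2` planes per site, each contributing `β_W²/8` at leading order). [folklore] -/
theorem su2_freeEnergy_two_sided {n : ℕ} (hn : 1 ≤ n) {βW : ℝ} (hβ : 0 ≤ βW) :
    (n : ℝ) * (n + 1) / 16 * βW ^ 2 * Real.exp (-(2 * n * (2 * n + 3) * βW)) ≤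
        freeEnergyDensity (n + 1) (fundamentalRep (Fin 2)) (βW / 2) + n * (n + 1) / 2 * βW ∧
      freeEnergyDensity (n + 1) (fundamentalRep (Fin 2)) (βW / 2) + n * (n + 1) / 2 * βW ≤
        (n : ℝ) * (n + 1) / 16 * βW ^ 2 * Real.exp (8 * n ^ 2 * βW) := by
  have hρ := TorusAreaLaw.isSpecialUnitaryModel_fundamentalRep 2
  have h := freeEnergyDensity_two_sided (d := n + 1) (fundamentalRep (Fin 2)) hρ le_rfl (by omega)
    (by positivity : (0 : ℝ) ≤ βW / 2)
  rw [HaarSecondMoments.charVariance_su2, card_planes_real] at h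
  push_cast at h
  obtain ⟨h1, h2⟩ := h
  constructor
  · have e1 : (n : ℝ) * (n + 1) / 16 * βW ^ 2 * Real.exp (-(2 * n * (2 * n + 3) * βW)) =
        (n : ℝ) * (n + 1) / 2 * (1 * (βW / 2) ^ 2 / 2) *
          Real.exp (-(2 * ((n : ℝ) + 1 - 1) * (2 * ((n : ℝ) + 1) + 1) * 2 * (βW / 2))) := by ring_nf
    have e2 : freeEnergyDensity (n + 1) (fundamentalRep (Fin 2)) (βW / 2) + (n : ℝ) * (n + 1) / 2 * 2 * (βW / 2) =
        freeEnergyDensity (n + 1) (fundamentalRep (Fin 2)) (βW / 2) + n * (n + 1) / 2 * βW := by ring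
    rw [e1, ← e2]; exact h1
  · have e1 : (n : ℝ) * (n + 1) / 16 * βW ^ 2 * Real.exp (8 * n ^ 2 * βW) =
        (n : ℝ) * (n + 1) / 2 * (1 * (βW / 2) ^ 2 / 2) * Real.exp (8 * ((n : ℝ) + 1 - 1) ^ 2 * 2 * (βW / 2)) := by ring_nf
    have e2 : freeEnergyDensity (n + 1) (fundamentalRep (Fin 2)) (βW / 2) + (n : ℝ) * (n + 1) / 2 * 2 * (βW / 2) =
        freeEnergyDensity (n + 1) (fundamentalRep (Fin 2)) (βW / 2) + n * (n + 1) / 2 * βW := by ring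
    rw [e1, ← e2]; exact h2

/-- ★ **Every `N ≥ 3`, `d = 3` (the `YM₃` lattices): `(3/4) β² e^{−28Nβ} ≤ f(β) + 3Nβ ≤ (3/4) β² e^{32Nβ}`** for every tree coupling
`β ≥ 0` (three planes, `V₀ = 1/2`). [folklore] -/
theorem suN_freeEnergy_two_sided_dim3 {N : ℕ} (hN : 3 ≤ N) {β : ℝ} (hβ : 0 ≤ β) :
    3 / 4 * β ^ 2 * Real.exp (-(28 * N * β)) ≤ freeEnergyDensity 3 (fundamentalRep (Fin N)) β + 3 * N * β ∧
      freeEnergyDensity 3 (fundamentalRep (Fin N)) β + 3 * N * β ≤ 3 / 4 * β ^ 2 * Real.exp (32 * N * β) := by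
  have hρ := TorusAreaLaw.isSpecialUnitaryModel_fundamentalRep N
  have h := freeEnergyDensity_two_sided (d := 3) (fundamentalRep (Fin N)) hρ (by omega) (by norm_num) hβ
  have hD : (Fintype.card {q : Fin 3 × Fin 3 // q.1 < q.2} : ℝ) = 3 := by
    rw [show Fintype.card {q : Fin 3 × Fin 3 // q.1 < q.2} = 3 by rfl]; norm_num
  rw [HaarSecondMoments.charVariance_suN hN, hD] at h
  push_cast at h
  obtain ⟨h1, h2⟩ := h
  constructor
  · have e1 : 3 / 4 * β ^ 2 * Real.exp (-(28 * N * β)) =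
        3 * (1 / 2 * β ^ 2 / 2) * Real.exp (-(2 * ((3 : ℝ) - 1) * (2 * (3 : ℝ) + 1) * N * β)) := by ring_nf
    rw [e1]; exact h1
  · have e1 : 3 / 4 * β ^ 2 * Real.exp (32 * N * β) =
        3 * (1 / 2 * β ^ 2 / 2) * Real.exp (8 * ((3 : ℝ) - 1) ^ 2 * N * β) := by ring_nf
    rw [e1]; exact h2

end Ratio

end FreeEnergyLaw

end Summit.Ventures.YMGap.RobustBall
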